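import Literature.RepresentationTheory.Semisimple.GradedOrbitRetract
import HarnessLib

/-!
# Graded modules with a degree-one endomorphism, IV: degreewise cancellation of a split-off string

This file is part of a small self-contained series (`GradedOrbitStrings`, `GradedOrbitRetract`,
`GradedOrbitReaching`, `GradedOrbitDegreewise`, `GradedOrbitConj`) proving the following
**conjugacy theorem** (`exists_graded_linearEquiv_conj`): let `R` be a ring containing a field
`K`, `M = ⨁_{k<N} gr k` a graded `R`-module, finite-dimensional over `K` and semisimple over
`R`, and `t`, `t'` two `R`-endomorphisms of degree `+1` which are *generic* — no non-zero
`R`-endomorphism of degree `-1` commutes with them; then `t' = g t g⁻¹` for a degree-preserving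
`R`-automorphism `g`.  For `R = K` this is the uniqueness of the rigid (= open-orbit)
representation of the equioriented quiver of type `A` with a given dimension vector; in the
language of Zelevinsky (*Induced representations of reductive 𝔭-adic groups II*, Ann. ÉNS 13
(1980), §§4, 8) it says that the multisegment with pairwise *unlinked* segments on a given
support is unique.  With `R = ℂ[W_K]` acting through a twisted Weil-group action it yields
A'Campo–Hevesi–Thorne–Whitmore, arXiv:2607.11763, Prop. 6.0.5 (2) (generic monodromy
operators on a fixed Frobenius-semisimple Weil representation form one orbit under the
centraliser), see `Literature/NumberTheory/GaloisRepresentations/GenericWeilDeligneOrbitProofs`.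

The proof is elementary and module-theoretic (no algebraic geometry, no Gabriel / Krull–Schmidt):
a *string* is `Z = ⨁_{r ≤ n} tʳ e(S)` for a simple `S` and `e : S → gr p`; a string born in a
degree `p` below which `S` does not occur splits off `t`-stably and compatibly with the grading
(`exists_isCompl_stringSum`); genericity passes to such summands; in a generic module the string
born at the bottom of a maximal interval of degrees occupied by `S` reaches its top
(`exists_comp_pow_ne_zero_of_occupied`); split off such longest strings for `t` and `t'`, cancel
the simple summands degreewise, and induct on `dim_K M`.

Conventions.  Everything is stated without auxiliary definitions: a grading is a family
`gr : ℕ → Submodule R M` (with `iSupIndep gr`, `⨆ gr = ⊤` and `gr k = ⊥` for `k ≥ N` where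
needed); "`t` has degree `+1`" is `∀ k, ∀ x ∈ gr k, t x ∈ gr (k + 1)`; a *string sum* is any
linear map `Ψ : (Fin (n+1) → S) →ₗ[R] M` with `Ψ s = ∑ r, t ^ (a + r) (e (s r))` (hypothesis
`hΨ`), so that lemmas apply to `∑ r, (t ^ r ∘ₗ e) ∘ₗ LinearMap.proj r` by `simp`.

## This file

* `nonempty_linearEquiv_of_isCompl_of_isCompl'` — cancellation of a simple summand across an
  isomorphism of the ambient modules;
* `isCompl_comap_range_stringSum`, `nonempty_linearEquiv_comap_range_stringSum`,
  `comap_range_stringSum_eq_bot` — the degree-`k` part of a split-off string is a copy of `S`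
  (if the string passes through `k`) or zero, complementary to the degree-`k` part of the
  complement;
* `nonempty_linearEquiv_comap_compl` — for strings of the same type, birth degree and length
  split off from graded modules with isomorphic homogeneous components, the complements again
  have isomorphic homogeneous components;
* `exists_linearEquiv_of_forall_eq_bot` — the degenerate case of the conjugacy theorem.
-/

namespace Literature.RepresentationTheory.Semisimple

open Module

variable {R : Type*} [Ring R] {M : Type*} [AddCommGroup M] [Module R M]

section Degreewise

variable (K : Type*) [Field K] [Algebra K R]

/-- Cancellation of a simple summand across an isomorphism of the ambient modules:
`N = A ⊕ B`, `N' = A' ⊕ B'`, `N ≅ N'`, `A ≅ A'` simple `⟹ B ≅ B'`. [folklore] -/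
theorem nonempty_linearEquiv_of_isCompl_of_isCompl' {N N' : Type*} [AddCommGroup N]
    [Module K N] [Module R N] [IsScalarTower K R N] [AddCommGroup N'] [Module K N']
    [Module R N'] [IsScalarTower K R N'] [FiniteDimensional K N'] (eN : N ≃ₗ[R] N')
    (A B : Submodule R N) (A' B' : Submodule R N') (hAB : IsCompl A B) (hA'B' : IsCompl A' B')
    [IsSimpleModule R A] (eA : A ≃ₗ[R] A') : Nonempty (B ≃ₗ[R] B') := by
  let A₁ : Submodule R N' := A.map (eN : N →ₗ[R] N')
  let B₁ : Submodule R N' := B.map (eN : N →ₗ[R] N')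
  have h₁ : IsCompl A₁ B₁ := (OrderIso.isCompl_iff (Submodule.orderIsoMapComap eN)).mp hAB
  let eA₁ : A ≃ₗ[R] A₁ := eN.submoduleMap A
  let eB₁ : B ≃ₗ[R] B₁ := eN.submoduleMap B
  haveI : IsSimpleModule R A₁ := IsSimpleModule.congr eA₁.symm
  obtain ⟨g⟩ := nonempty_linearEquiv_of_isCompl_of_isCompl K A₁ B₁ A' B' h₁ hA'B'
    (eA₁.symm ≪≫ₗ eA)
  exact ⟨eB₁ ≪≫ₗ g⟩

omit [Algebra K R] in
/-- `P ∩ Q` viewed inside `Q` or inside `P` is the same module. [folklore] -/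
theorem nonempty_linearEquiv_comap_subtype_comm {N : Type*} [AddCommGroup N] [Module R N]
    (P Q : Submodule R N) : Nonempty (↥(P.comap Q.subtype) ≃ₗ[R] ↥(Q.comap P.subtype)) :=
  ⟨{ toFun := fun x => ⟨⟨(x : Q), x.2⟩, (x : Q).2⟩
     invFun := fun x => ⟨⟨(x : P), x.2⟩, (x : P).2⟩
     map_add' := fun _ _ => rfl
     map_smul' := fun _ _ => rfl
     left_inv := fun _ => rfl
     right_inv := fun _ => rfl }⟩

omit [Algebra K R] in
/-- In the situation of the splitting lemma, the degree-`k` parts of the string `Z = range Ψ`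
and of its complement `C` are complementary inside `gr k`, and `Z ∩ gr k` consists of the
single terms `Ψ (Pi.single r s₀)` with `p + r = k`. [folklore] -/
theorem isCompl_comap_range_stringSum {L : Type*} [AddCommGroup L] [Module R L]
    (grL : ℕ → Submodule R L) {S : Type*} [AddCommGroup S] [Module R S] {p c : ℕ}
    (Φ : (Fin (c + 1) → S) →ₗ[R] L) (D : Submodule R L) (hdisj : Disjoint (LinearMap.range Φ) D)
    (hspl : ∀ k, ∀ x ∈ grL k, ∃ (r : Fin (c + 1)) (s₀ : S), ∃ y ∈ D,
      y ∈ grL k ∧ (s₀ ≠ 0 → p + r = k) ∧ x = Φ (Pi.single r s₀) + y) (k : ℕ) :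
    IsCompl ((LinearMap.range Φ).comap (grL k).subtype) (D.comap (grL k).subtype) ∧
      (∀ x : grL k, (x : L) ∈ LinearMap.range Φ → ∃ (r : Fin (c + 1)) (s₀ : S),
        (s₀ ≠ 0 → p + r = k) ∧ (x : L) = Φ (Pi.single r s₀)) := by
  have hstruct : ∀ x : grL k, (x : L) ∈ LinearMap.range Φ → ∃ (r : Fin (c + 1)) (s₀ : S),
      (s₀ ≠ 0 → p + r = k) ∧ (x : L) = Φ (Pi.single r s₀) := by
    intro x hx
    obtain ⟨r, s₀, y, hyD, -, hs₀, hxy⟩ := hspl k x x.2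
    refine ⟨r, s₀, hs₀, ?_⟩
    have hy : y ∈ LinearMap.range Φ := by
      have : y = (x : L) - Φ (Pi.single r s₀) := by rw [hxy]; abel
      rw [this]
      exact sub_mem hx ⟨_, rfl⟩
    have hy0 : y = 0 := (Submodule.disjoint_def.mp hdisj) y hy hyD
    rw [hxy, hy0, add_zero]
  refine ⟨⟨?_, ?_⟩, hstruct⟩
  · rw [Submodule.disjoint_def]
    intro x hx1 hx2
    exact Subtype.ext ((Submodule.disjoint_def.mp hdisj) _ hx1 hx2)
  · rw [codisjoint_iff, eq_top_iff]
    rintro x -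
    obtain ⟨r, s₀, y, hyD, hyk, -, hxy⟩ := hspl k x x.2
    have hz : Φ (Pi.single r s₀) ∈ grL k := by
      have : Φ (Pi.single r s₀) = (x : L) - y := by rw [hxy]; abel
      rw [this]; exact sub_mem x.2 hyk
    refine Submodule.mem_sup.mpr ⟨⟨_, hz⟩, ⟨_, rfl⟩, ⟨y, hyk⟩, hyD, ?_⟩
    exact Subtype.ext hxy.symm

omit [Algebra K R] in
/-- If the string passes through degree `k = p + r₀`, its degree-`k` part is a copy of `S`.
[folklore] -/
theorem nonempty_linearEquiv_comap_range_stringSum {L : Type*} [AddCommGroup L] [Module R L]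
    (grL : ℕ → Submodule R L) {S : Type*} [AddCommGroup S] [Module R S] {p c : ℕ}
    (Φ : (Fin (c + 1) → S) →ₗ[R] L) (hΦinj : Function.Injective Φ)
    (hΦdeg : ∀ (r : Fin (c + 1)) (s : S), Φ (Pi.single r s) ∈ grL (p + r)) (k : ℕ)
    (hstr : ∀ x : grL k, (x : L) ∈ LinearMap.range Φ → ∃ (r : Fin (c + 1)) (s₀ : S),
      (s₀ ≠ 0 → p + r = k) ∧ (x : L) = Φ (Pi.single r s₀))
    (r₀ : Fin (c + 1)) (hr₀ : p + (r₀ : ℕ) = k) :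
    Nonempty (S ≃ₗ[R] ↥((LinearMap.range Φ).comap (grL k).subtype)) := by
  classical
  let α : S →ₗ[R] grL k := LinearMap.codRestrict (grL k)
    (Φ ∘ₗ LinearMap.single R (fun _ => S) r₀) (fun s => by
      change Φ (Pi.single r₀ s) ∈ grL k
      rw [← hr₀]; exact hΦdeg r₀ s)
  let α' : S →ₗ[R] ↥((LinearMap.range Φ).comap (grL k).subtype) :=
    LinearMap.codRestrict _ α (fun s => ⟨Pi.single r₀ s, rfl⟩)
  refine ⟨LinearEquiv.ofBijective α' ⟨?_, ?_⟩⟩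
  · intro s s' h
    have : Φ (Pi.single r₀ s) = Φ (Pi.single r₀ s') :=
      congrArg (fun x : ↥((LinearMap.range Φ).comap (grL k).subtype) => ((x : grL k) : L)) h
    have := hΦinj this
    simpa using congr_fun this r₀
  · intro x
    obtain ⟨r, s₀, hs₀, hx⟩ := hstr x x.2
    by_cases h0 : s₀ = 0
    · refine ⟨0, ?_⟩
      apply Subtype.ext; apply Subtype.ext
      change Φ (Pi.single r₀ 0) = ((x : grL k) : L)
      rw [hx, h0, Pi.single_zero, Pi.single_zero]
    · have hr : r = r₀ := by
        apply Fin.ext; have := hs₀ h0; omega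
      refine ⟨s₀, ?_⟩
      apply Subtype.ext; apply Subtype.ext
      change Φ (Pi.single r₀ s₀) = ((x : grL k) : L)
      rw [hx, hr]

omit [Algebra K R] in
/-- If the string misses degree `k`, its degree-`k` part vanishes. [folklore] -/
theorem comap_range_stringSum_eq_bot {L : Type*} [AddCommGroup L] [Module R L]
    (grL : ℕ → Submodule R L) {S : Type*} [AddCommGroup S] [Module R S] {p c : ℕ}
    (Φ : (Fin (c + 1) → S) →ₗ[R] L) (k : ℕ) (hk : ¬ (p ≤ k ∧ k ≤ p + c))
    (hstr : ∀ x : grL k, (x : L) ∈ LinearMap.range Φ → ∃ (r : Fin (c + 1)) (s₀ : S),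
      (s₀ ≠ 0 → p + r = k) ∧ (x : L) = Φ (Pi.single r s₀)) :
    (LinearMap.range Φ).comap (grL k).subtype = ⊥ := by
  rw [eq_bot_iff]
  intro x hx
  obtain ⟨r, s₀, hs₀, hx'⟩ := hstr x hx
  have h0 : s₀ = 0 := by
    by_contra h
    have := hs₀ h
    have := Fin.is_le r
    omega
  rw [Submodule.mem_bot]
  apply Subtype.ext
  rw [hx', h0, Pi.single_zero, map_zero]; rfl

/-- **Degreewise cancellation of a split-off string.**  In the situation of the splitting lemma
for graded modules `M`, `M'` with isomorphic homogeneous components, applied to strings of the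
same simple type `S`, the same birth degree `p` and the same length `c + 1`, the complements
have isomorphic homogeneous components. [folklore] -/
theorem nonempty_linearEquiv_comap_compl {M : Type*} [AddCommGroup M] [Module K M]
    [Module R M] [IsScalarTower K R M] {M' : Type*} [AddCommGroup M']
    [Module K M'] [Module R M'] [IsScalarTower K R M'] [FiniteDimensional K M']
    (gr : ℕ → Submodule R M) (gr' : ℕ → Submodule R M')
    (hiso : ∀ k, Nonempty (gr k ≃ₗ[R] gr' k))
    {S : Type*} [AddCommGroup S] [Module R S] [IsSimpleModule R S] {p c : ℕ}
    (Ψ : (Fin (c + 1) → S) →ₗ[R] M) (Ψ' : (Fin (c + 1) → S) →ₗ[R] M')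
    (hΨinj : Function.Injective Ψ) (hΨ'inj : Function.Injective Ψ')
    (hΨdeg : ∀ (r : Fin (c + 1)) (s : S), Ψ (Pi.single r s) ∈ gr (p + r))
    (hΨ'deg : ∀ (r : Fin (c + 1)) (s : S), Ψ' (Pi.single r s) ∈ gr' (p + r))
    (C : Submodule R M) (C' : Submodule R M')
    (hdis : Disjoint (LinearMap.range Ψ) C) (hdis' : Disjoint (LinearMap.range Ψ') C')
    (hsplit : ∀ k, ∀ x ∈ gr k, ∃ (r : Fin (c + 1)) (s₀ : S), ∃ y ∈ C,
      y ∈ gr k ∧ (s₀ ≠ 0 → p + r = k) ∧ x = Ψ (Pi.single r s₀) + y)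
    (hsplit' : ∀ k, ∀ x ∈ gr' k, ∃ (r : Fin (c + 1)) (s₀ : S), ∃ y ∈ C',
      y ∈ gr' k ∧ (s₀ ≠ 0 → p + r = k) ∧ x = Ψ' (Pi.single r s₀) + y) (k : ℕ) :
    Nonempty (↥((gr k).comap C.subtype) ≃ₗ[R] ↥((gr' k).comap C'.subtype)) := by
  classical
  obtain ⟨eN⟩ := hiso k
  obtain ⟨hAB, hA⟩ := isCompl_comap_range_stringSum gr Ψ C hdis hsplit k
  obtain ⟨hA'B', hA'⟩ := isCompl_comap_range_stringSum gr' Ψ' C' hdis' hsplit' k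
  -- conclude `B ≃ B'`, then swap the comaps
  suffices h : Nonempty (↥(C.comap (gr k).subtype) ≃ₗ[R] ↥(C'.comap (gr' k).subtype)) by
    obtain ⟨g⟩ := h
    obtain ⟨s1⟩ := nonempty_linearEquiv_comap_subtype_comm (gr k) C
    obtain ⟨s2⟩ := nonempty_linearEquiv_comap_subtype_comm C' (gr' k)
    exact ⟨s1 ≪≫ₗ g ≪≫ₗ s2⟩
  haveI : FiniteDimensional K (gr' k) := finite_of_submodule K (gr' k)
  by_cases hk : p ≤ k ∧ k ≤ p + c
  · -- the string meets degree `k` in a copy of `S`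
    let r₀ : Fin (c + 1) := ⟨k - p, by omega⟩
    have hr₀ : p + (r₀ : ℕ) = k := by change p + (k - p) = k; omega
    obtain ⟨eA⟩ := nonempty_linearEquiv_comap_range_stringSum gr Ψ hΨinj hΨdeg k hA r₀ hr₀
    obtain ⟨eA'⟩ := nonempty_linearEquiv_comap_range_stringSum gr' Ψ' hΨ'inj hΨ'deg k hA' r₀ hr₀
    haveI : IsSimpleModule R ↥((LinearMap.range Ψ).comap (gr k).subtype) :=
      IsSimpleModule.congr eA.symm
    exact nonempty_linearEquiv_of_isCompl_of_isCompl' K eN _ _ _ _ hAB hA'B' (eA.symm ≪≫ₗ eA')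
  · -- the string misses degree `k`: `A = ⊥`, `A' = ⊥`
    have hB : C.comap (gr k).subtype = ⊤ := by
      have := hAB
      rw [comap_range_stringSum_eq_bot gr Ψ k hk hA] at this
      exact eq_top_of_bot_isCompl this
    have hB' : C'.comap (gr' k).subtype = ⊤ := by
      have := hA'B'
      rw [comap_range_stringSum_eq_bot gr' Ψ' k hk hA'] at this
      exact eq_top_of_bot_isCompl this
    rw [hB, hB']
    exact ⟨Submodule.topEquiv ≪≫ₗ eN ≪≫ₗ Submodule.topEquiv.symm⟩

end Degreewise

/-- The degenerate case of the conjugacy theorem: all homogeneous components vanish.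
[folklore] -/
theorem exists_linearEquiv_of_forall_eq_bot {M : Type*} [AddCommGroup M] [Module R M]
    {M' : Type*} [AddCommGroup M'] [Module R M']
    (gr : ℕ → Submodule R M) (hsup : ⨆ k, gr k = ⊤) (gr' : ℕ → Submodule R M')
    (hsup' : ⨆ k, gr' k = ⊤) (hiso : ∀ k, Nonempty (gr k ≃ₗ[R] gr' k))
    (h0 : ∀ k, gr k = ⊥) (t : M →ₗ[R] M) (t' : M' →ₗ[R] M') :
    ∃ g : M ≃ₗ[R] M', (∀ k, ∀ x ∈ gr k, g x ∈ gr' k) ∧ ∀ x, g (t x) = t' (g x) := by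
  have h0' : ∀ k, gr' k = ⊥ := by
    intro k
    obtain ⟨e⟩ := hiso k
    haveI : Subsingleton (gr k) := by rw [h0 k]; infer_instance
    haveI : Subsingleton (gr' k) := e.symm.toEquiv.subsingleton
    exact (Submodule.subsingleton_iff_eq_bot).mp inferInstance
  have hM : ∀ x : M, x = 0 := by
    intro x
    have hx : x ∈ ⨆ k, gr k := hsup ▸ Submodule.mem_top
    simpa only [h0, iSup_bot, Submodule.mem_bot] using hx
  have hM' : ∀ x : M', x = 0 := by
    intro x
    have hx : x ∈ ⨆ k, gr' k := hsup' ▸ Submodule.mem_top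
    simpa only [h0', iSup_bot, Submodule.mem_bot] using hx
  haveI : Subsingleton M := ⟨fun a b => by rw [hM a, hM b]⟩
  haveI : Subsingleton M' := ⟨fun a b => by rw [hM' a, hM' b]⟩
  refine ⟨LinearEquiv.ofSubsingleton M M', fun k x _ => ?_, fun x => Subsingleton.elim _ _⟩
  rw [hM' (LinearEquiv.ofSubsingleton M M' x)]
  exact zero_mem _

end Literature.RepresentationTheory.Semisimple
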